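import Summits.CriticalPhenomena.PercolationContinuityZ3.Theorems.PercNearOneGluingNoHeavyQuantTwoLayerClosure
import HarnessLib

/-!
# QUANT lane R8 on trees: the FLOOR-RESTRICTED two-layer induction — K-SGC at floors `≥ ρ` already gives the far-relay row for every
# tree-built law at floor `≥ ρ` (the near-one programme: `ρ = 1/2` needs K-SGC only for `u = y/(1−y) ≥ 1`)

builds on p205010 (kernel theorem, internal audit signed; external expert review pending)

Support file (`--supports stmt-CriticalPhenomena-4575`), QUANT lane seat prim-quant-arm-2 (gen 38), rung R8 of
`run/shared/lean/prim/quant/LADDER.md`; memo `run/shared/lean/prim/quant/prim-quant-arm-2-g38/TWO-LAYER-CLOSURE-G38.md` §8.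
Theorems only, standard axioms, no sorries.  Vocabulary: `LawDec.TwoLayer`, `LawDec.TwoLayerConvClosed`'s binder, `TreeBuilt` (`…QuantTwoLayerClosure`,
`…QuantSDEC`).

THE POINT.  In `treeBuilt_sTwoLayer` the invariant quantifies over ALL gates `q ∈ (0,1]`, so the conjecture is consumed at every floor `y = q·x`, however
small.  But floors only DECREASE towards the root (gates multiply): if the final floor is `≥ ρ`, every floor met on the way is `≥ ρ`, and the invariant
can be restricted to the gates `q` with `ρ ≤ q·x`.  Hence **K-SGC restricted to floors `y ≥ ρ`** (`TwoLayerConvClosedAbove ρ`, written here as a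
hypothesis, not a new definition) **⟹ the two-layer family, in particular the far-relay row `x ≤ μ{> j}` (`2j < mean`), for every tree-built law at
floor `x ≥ ρ`** (`treeBuilt_twoLayer_of_floor`, `treeBuilt_row_of_floor`).  With `ρ = 1/2` the hypothesis involves only `u ≥ 1`, where the
convolution case (`q = 1`) is THEOREM A (`twoLayer_lconv_of_half_le`, `…QuantTwoLayerHalf`) and the gated case has tensor certificates at every tested
parameter tuple (memo §6, §10; kit j212767: 123 423 / 0).
HONEST STATUS: a reduction; `TwoLayerConvClosed` (any floor), `TreeBuiltFAR`, `FarTreeRow` OPEN; the RATE class log\* and the honest sentence of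
`run/shared/lean/prim/quant/README.md` are unchanged.

* **`LawDec.treeBuilt_twoLayer_of_floor`**, **`LawDec.treeBuilt_row_of_floor`**.

[this work].  Nothing here is cited as a published result.  The gluing rows served [cite: KozmaNitzan2024, Conjecture 3 (p. 15)]; product measure
[cite: Grimmett1999, §1.3 p. 10].
-/

noncomputable section

namespace Summit.CriticalPhenomena.PercolationContinuityZ3.Theorems

namespace Quant

open Finset

namespace LawDec

/-- **THE FLOOR-RESTRICTED INDUCTION.**  Fix `ρ`.  Assume K-SGC for all floors `y ≥ ρ` (the binder of `TwoLayerConvClosed` with the extra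
hypothesis `ρ ≤ y`).  Then every tree-built law `TreeBuilt x M μ` with `ρ ≤ x` satisfies: for every gate `0 < q ≤ 1` with `ρ ≤ q·x`, `gate μ q` is
two-layer at floor `q·x`, threshold `q·(mean μ)`. [this work] -/
theorem treeBuilt_twoLayer_of_floor (ρ : ℝ)
    (hC : ∀ (y q : ℝ) (M₁ M₂ : ℕ) (μ₁ μ₂ : ℕ → ℝ), ρ ≤ y →
      0 < y → y < 1 → 0 < q → q ≤ 1 →
      (∀ h, 0 ≤ μ₁ h) → (∀ h, M₁ < h → μ₁ h = 0) → (∑ h ∈ Finset.range (M₁ + 1), μ₁ h = 1) →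
      y * (M₁ : ℝ) ≤ q * ∑ h ∈ Finset.range (M₁ + 1), (h : ℝ) * μ₁ h →
      (∀ h, 0 ≤ μ₂ h) → (∀ h, M₂ < h → μ₂ h = 0) → (∑ h ∈ Finset.range (M₂ + 1), μ₂ h = 1) →
      y * (M₂ : ℝ) ≤ q * ∑ h ∈ Finset.range (M₂ + 1), (h : ℝ) * μ₂ h →
      TwoLayer y (q * ∑ h ∈ Finset.range (M₁ + 1), (h : ℝ) * μ₁ h) M₁ (gate μ₁ q) →
      TwoLayer y (q * ∑ h ∈ Finset.range (M₂ + 1), (h : ℝ) * μ₂ h) M₂ (gate μ₂ q) →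
      TwoLayer y (q * ((∑ h ∈ Finset.range (M₁ + 1), (h : ℝ) * μ₁ h) + ∑ h ∈ Finset.range (M₂ + 1), (h : ℝ) * μ₂ h))
        (M₁ + M₂) (gate (lconv M₁ M₂ μ₁ μ₂) q))
    {x : ℝ} {M : ℕ} {μ : ℕ → ℝ} (h : TreeBuilt x M μ) :
    ρ ≤ x → ∀ q : ℝ, 0 < q → q ≤ 1 → ρ ≤ q * x →
      TwoLayer (q * x) (q * ∑ h ∈ Finset.range (M + 1), (h : ℝ) * μ h) M (gate μ q) := by
  induction h with
  | nil x₀ hx0 hx1 => intro _ q hq0 hq1 _; exact sTwoLayer_nil x₀ q hq0 hq1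
  | relay x₀ hx0 hx1 => intro _ q hq0 hq1 _; exact sTwoLayer_relay x₀ hx1.le q hq0 hq1
  | @conv x₀ M₁ M₂ μ₁ μ₂ h₁ h₂ ih₁ ih₂ =>
    intro hρ q hq0 hq1 hρq
    obtain ⟨hx0, hx1, n1, z1, s1, t1⟩ := treeBuilt_lawFacts h₁
    obtain ⟨_, _, n2, z2, s2, t2⟩ := treeBuilt_lawFacts h₂
    have hy0 : 0 < q * x₀ := mul_pos hq0 hx0
    have hy1 : q * x₀ < 1 := by nlinarith
    have hta1 : q * x₀ * (M₁ : ℝ) ≤ q * ∑ h ∈ Finset.range (M₁ + 1), (h : ℝ) * μ₁ h := by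
      rw [mul_assoc]; exact mul_le_mul_of_nonneg_left t1 hq0.le
    have hta2 : q * x₀ * (M₂ : ℝ) ≤ q * ∑ h ∈ Finset.range (M₂ + 1), (h : ℝ) * μ₂ h := by
      rw [mul_assoc]; exact mul_le_mul_of_nonneg_left t2 hq0.le
    rw [sum_mul_lconv _ _ _ _ s1 s2]
    exact hC (q * x₀) q M₁ M₂ μ₁ μ₂ hρq hy0 hy1 hq0 hq1 n1 z1 s1 hta1 n2 z2 s2 hta2
      (ih₁ hρ q hq0 hq1 hρq) (ih₂ hρ q hq0 hq1 hρq)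
  | @gate x₀ M₀ μ₀ q₀ hq₀0 hq₀1 h ih =>
    intro hρ q hq0 hq1 hρq
    obtain ⟨hx0, _, _, _, _, _⟩ := treeBuilt_lawFacts h
    -- the floor before the gate is larger: `ρ ≤ q·(q₀·x₀) ≤ x₀`
    have hρ' : ρ ≤ x₀ := by nlinarith [mul_pos hq0 hq₀0]
    rw [gate_gate, sum_mul_gate, show q * (q₀ * x₀) = (q * q₀) * x₀ by ring,
      show q * (q₀ * ∑ h ∈ Finset.range (M₀ + 1), (h : ℝ) * μ₀ h) = (q * q₀) * ∑ h ∈ Finset.range (M₀ + 1), (h : ℝ) * μ₀ h by ring]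
    exact ih hρ' (q * q₀) (mul_pos hq0 hq₀0) (by nlinarith) (by rw [mul_assoc]; exact hρq)
  | @mono x₀ x' M₀ μ₀ h hx'0 hxx ih =>
    intro hρ q hq0 hq1 hρq
    obtain ⟨_, _, n1, _, _, _⟩ := treeBuilt_lawFacts h
    have hρqx : ρ ≤ q * x₀ := le_trans hρq (mul_le_mul_of_nonneg_left hxx hq0.le)
    exact twoLayer_mono_floor (gate_nonneg' n1 hq0.le hq1) (ih (le_trans hρ hxx) q hq0 hq1 hρqx)
      (mul_le_mul_of_nonneg_left hxx hq0.le)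

/-- **THE FAR-RELAY ROW AT FLOORS `≥ ρ` from K-SGC at floors `≥ ρ`**: every tree-built law `TreeBuilt x M μ` with `ρ ≤ x` has `x ≤ μ{> j}` whenever
`2j < mean`.  (With `ρ = 1/2`: the near-one half of `TreeBuiltFAR` from K-SGC in the regime `u ≥ 1` only.) [this work] -/
theorem treeBuilt_row_of_floor (ρ : ℝ)
    (hC : ∀ (y q : ℝ) (M₁ M₂ : ℕ) (μ₁ μ₂ : ℕ → ℝ), ρ ≤ y →
      0 < y → y < 1 → 0 < q → q ≤ 1 →
      (∀ h, 0 ≤ μ₁ h) → (∀ h, M₁ < h → μ₁ h = 0) → (∑ h ∈ Finset.range (M₁ + 1), μ₁ h = 1) →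
      y * (M₁ : ℝ) ≤ q * ∑ h ∈ Finset.range (M₁ + 1), (h : ℝ) * μ₁ h →
      (∀ h, 0 ≤ μ₂ h) → (∀ h, M₂ < h → μ₂ h = 0) → (∑ h ∈ Finset.range (M₂ + 1), μ₂ h = 1) →
      y * (M₂ : ℝ) ≤ q * ∑ h ∈ Finset.range (M₂ + 1), (h : ℝ) * μ₂ h →
      TwoLayer y (q * ∑ h ∈ Finset.range (M₁ + 1), (h : ℝ) * μ₁ h) M₁ (gate μ₁ q) →
      TwoLayer y (q * ∑ h ∈ Finset.range (M₂ + 1), (h : ℝ) * μ₂ h) M₂ (gate μ₂ q) →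
      TwoLayer y (q * ((∑ h ∈ Finset.range (M₁ + 1), (h : ℝ) * μ₁ h) + ∑ h ∈ Finset.range (M₂ + 1), (h : ℝ) * μ₂ h))
        (M₁ + M₂) (gate (lconv M₁ M₂ μ₁ μ₂) q))
    {x : ℝ} {M : ℕ} {μ : ℕ → ℝ} (h : TreeBuilt x M μ) (hρ : ρ ≤ x) (j : ℕ)
    (hdom : (2 * j : ℝ) < ∑ h ∈ Finset.range (M + 1), (h : ℝ) * μ h) :
    x ≤ ∑ h ∈ Finset.Ico (j + 1) (M + 1), μ h := by
  obtain ⟨hx0, hx1, n1, z1, s1, t1⟩ := treeBuilt_lawFacts h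
  have hS := treeBuilt_twoLayer_of_floor ρ hC h hρ 1 one_pos le_rfl (by rw [one_mul]; exact hρ)
  rw [gate_one, one_mul, one_mul] at hS
  have hjj := hS j j le_rfl (by linarith)
  have hsplit := sum_le_add_sum_gt M j μ
  rw [s1] at hsplit
  rw [← sum_ite_succ_le_eq_Ico]
  nlinarith [hjj, hsplit]

end LawDec

end Quant

end Summit.CriticalPhenomena.PercolationContinuityZ3.Theorems
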